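import Mathlib
import Summits.Ventures.DiscreteObjects.Mahler.SmallMeasureCensus
import Summits.Ventures.DiscreteObjects.Mahler.GraeffeIdentity
import Summits.Ventures.DiscreteObjects.Mahler.ReciprocalCoeffBound
import Summits.Ventures.DiscreteObjects.Mahler.PowerSumBound
import Summits.Ventures.DiscreteObjects.Mahler.ReciprocalFactorisation
import Summits.Ventures.DiscreteObjects.Mahler.ReciprocalFamilies
import Summits.Ventures.DiscreteObjects.Mahler.GraeffePalindromic

/-!
# Soundness of the census pruning tests for ALL enumerated families (venture `DiscreteObjects`, target L)

Cell `pub-namedobj`, seat `pub-namedobj-mahler-g2`. Framing: lottery ticket; floor = certified bounds/negative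
ranges.

Assembly of `ReciprocalFactorisation` / `ReciprocalFamilies` (shape of the three families), `ReciprocalCoeffBound`
(T2), `PowerSumBound` (T1) and `GraeffeIdentity` (transfer to iterates) into the statements the census engines
(`HOME/code/censusL/{engineA/censusA.c, engineB.py, thresholds.py, polyz.py}`) rely on. For a monic `P ∈ ℤ[x]`
of degree `n` in one of the enumerated families — `rec` (`a_j = a_{n-j}`, any `n ≥ 2`), `anti` (`a_j = -a_{n-j}`,
`n` even) — and a bound `B` with `M(P) < B`:

* coefficient test: `|a_i(P)| < [x^i] (x² + (B + 1/B) x + 1)(x + 1)^{n-2}` for `1 ≤ i ≤ n-1`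
  (`rec_even_coeff_test`, `rec_odd_coeff_test`, `anti_coeff_test`);
* power-sum test: `‖Σ_{z ∈ roots(P)} z^k‖ < (n-2) + B^k + B^{-k}` for `k ≥ 1`
  (`rec_even_powerSum_test`, `rec_odd_powerSum_test`, `anti_powerSum_test`);
* Graeffe transfer: if `Q` is an `m`-step Graeffe iterate of `P` then `M(Q) < B^{2^m}` (`graeffe_bound`), so the
  same tests apply to `Q` (in its own family) with `B^{2^m}` — `thresholds.py` exactly.

These are, symbol for symbol, the inequalities whose `floor_strict` integer thresholds `engineB.py` applies
(`Census.run` levels and `Census.leaf`: `T2thr[m][k] = floor_strict(n-2+B_m^k+B_m^-k)`,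
`T1thr[m][j] = floor_strict([z^j](1+(B_m+1/B_m)z+z²)(1+z)^{n-2})`, `j = 1..n-1`), engine A being parity-checked
against engine B. Hence the survivor lists are COMPLETE for `{P in the family : M(P) < B}` as a matter of theorem,
given that the integer arithmetic implements the formulas. The family of the ITERATES is settled here too:
`GraeffePalindromic.lean` shows that every Graeffe iterate of an even-degree `rec` polynomial is `rec`, and
`EngineSoundnessIterates.lean` shows that the first iterate of an even-degree `anti` polynomial is `rec` (so all
further ones are) and states the residual-free iterate forms `rec_even_coeff_test_iterate` /
`rec_even_powerSum_test_iterate` / `anti_coeff_test_iterate` / `anti_powerSum_test_iterate`. (Odd `n`: the iterates of an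
odd-degree `rec` polynomial are odd-degree `anti` polynomials `(x-1)·R`; that case — used by the cell only for the
control row `n = 45` — is assembled in `EngineSoundnessOdd.lean`.)
-/

namespace Summit.Ventures.DiscreteObjects.Mahler

open Polynomial

/-! ## Generic tools -/

/-- Strict transfer: domination by `(x² + m x + 1)·S` with `S ≥ 0` coefficientwise and `m < b` gives the strict
bound with `b` at every index `j+1` where `S.coeff j > 0`. -/
theorem strict_of_dominates (p : ℂ[X]) {m b : ℝ} (hmb : m < b) (S : ℝ[X]) (hS : CoeffNonneg S)
    (hdom : Dominates ((X ^ 2 + C m * X + 1 : ℝ[X]) * S) p) (j : ℕ) (hj : 0 < S.coeff j) :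
    ‖p.coeff (j + 1)‖ < ((X ^ 2 + C b * X + 1 : ℝ[X]) * S).coeff (j + 1) := by
  have h1 := hdom (j + 1)
  rw [coeff_realQuad_mul] at h1 ⊢
  have hSj : 0 ≤ (if j = 0 then (0 : ℝ) else S.coeff (j - 1)) := by
    split_ifs
    · exact le_rfl
    · exact hS _
  nlinarith [mul_lt_mul_of_pos_right hmb hj, hS (j + 1)]

/-- `(x+1)^N` has nonnegative coefficients, positive exactly up to `N`. -/
theorem coeff_X_add_one_pow_real (N j : ℕ) : ((X + 1 : ℝ[X]) ^ N).coeff j = (N.choose j : ℝ) :=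
  Polynomial.coeff_X_add_one_pow ℝ N j

/-- `(x+1)^N` has nonnegative coefficients. -/
theorem coeffNonneg_X_add_one_pow (N : ℕ) : CoeffNonneg ((X + 1 : ℝ[X]) ^ N) := by
  intro j; rw [coeff_X_add_one_pow_real]; positivity

/-- The coefficients of `(x+1)^N` of index `≤ N` are positive. -/
theorem coeff_X_add_one_pow_pos {N j : ℕ} (hj : j ≤ N) : 0 < ((X + 1 : ℝ[X]) ^ N).coeff j := by
  rw [coeff_X_add_one_pow_real]; exact_mod_cast Nat.choose_pos hj

/-- `x + 1/x` is strictly increasing on `[1,∞)`. -/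
theorem add_inv_lt_add_inv {x y : ℝ} (hx : 1 ≤ x) (hxy : x < y) : x + x⁻¹ < y + y⁻¹ := by
  have := pow_add_inv_pow_lt hx hxy (k := 1) one_pos
  simpa using this

/-- `M(P) ≥ 1` for monic integer `P`. -/
theorem one_le_intMahlerMeasure_of_monic {P : ℤ[X]} (hP : P.Monic) : 1 ≤ intMahlerMeasure P := by
  unfold intMahlerMeasure
  apply one_le_mahlerMeasure_of_one_le_norm_leadingCoeff
  rw [(hP.map _).leadingCoeff, norm_one]

/-- The real majorant of a product of `d` reciprocal quadratics, in `(x+1)`-power form. -/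
theorem dominates_rec_product (s : Multiset ℂ) (hs : s ≠ 0) :
    Dominates ((X ^ 2 + C ((s.map fun t => (X ^ 2 - C t * X + 1 : ℂ[X])).prod.mahlerMeasure +
        ((s.map fun t => (X ^ 2 - C t * X + 1 : ℂ[X])).prod.mahlerMeasure)⁻¹) * X + 1 : ℝ[X]) *
        (X + 1) ^ (2 * (Multiset.card s - 1))) (s.map fun t => (X ^ 2 - C t * X + 1 : ℂ[X])).prod := by
  intro j
  have h := reciprocal_coeff_bound s hs j
  have hpow : ((X + 1 : ℝ[X]) ^ (2 * (Multiset.card s - 1))) = (X ^ 2 + C 2 * X + 1) ^ (Multiset.card s - 1) := by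
    rw [pow_mul]; congr 1; rw [show (C 2 : ℝ[X]) = 2 from map_ofNat C 2]; ring
  rw [hpow]; exact h

/-! ## The `rec` family, even degree -/

/-- **T2, rec family, even degree `n = 2d ≥ 2`.** -/
theorem rec_even_coeff_test (P : ℤ[X]) (d : ℕ) (hd : 1 ≤ d) (hmonic : P.Monic) (hdeg : P.natDegree = 2 * d)
    (hpal : ∀ j ≤ 2 * d, P.coeff j = P.coeff (2 * d - j)) {B : ℝ} (hB : intMahlerMeasure P < B)
    (i : ℕ) (hi1 : 1 ≤ i) (hi2 : i ≤ 2 * d - 1) :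
    (|P.coeff i| : ℝ) < ((X ^ 2 + C (B + B⁻¹) * X + 1 : ℝ[X]) * (X + 1) ^ (2 * d - 2)).coeff i := by
  obtain ⟨s, hcard, hP⟩ := int_palindromic_factorisation P d hmonic hdeg hpal
  have hs : s ≠ 0 := by intro h; rw [h, Multiset.card_zero] at hcard; omega
  have hdom := dominates_rec_product s hs
  rw [← hP, hcard] at hdom
  have hM1 := one_le_intMahlerMeasure_of_monic hmonic
  obtain ⟨j, rfl⟩ : ∃ j, i = j + 1 := ⟨i - 1, by omega⟩
  have h := strict_of_dominates _ (add_inv_lt_add_inv hM1 hB) _ (coeffNonneg_X_add_one_pow _) hdom j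
    (coeff_X_add_one_pow_pos (by omega))
  rw [show 2 * d - 2 = 2 * (d - 1) by omega]
  rw [coeff_map] at h
  simpa [Complex.norm_intCast] using h

/-- **T1, rec family, even degree.** -/
theorem rec_even_powerSum_test (P : ℤ[X]) (d : ℕ) (hd : 1 ≤ d) (hmonic : P.Monic) (hdeg : P.natDegree = 2 * d)
    (hpal : ∀ j ≤ 2 * d, P.coeff j = P.coeff (2 * d - j)) {B : ℝ} (hB : intMahlerMeasure P < B) {k : ℕ}
    (hk : 0 < k) :
    ‖(((P.map (Int.castRingHom ℂ)).roots).map fun z => z ^ k).sum‖ < (2 * d - 2 : ℝ) + B ^ k + (B ^ k)⁻¹ := by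
  obtain ⟨s', hcard, hs0, hP⟩ := palindromic_halfRoots_factorisation (P.map (Int.castRingHom ℂ)) d
    (hmonic.map _) (by rw [natDegree_map_eq_of_injective (Int.castRingHom ℂ).injective_int, hdeg])
    (fun j hj => by rw [coeff_map, coeff_map, hpal j hj])
  have hs : s' ≠ 0 := by intro h; rw [h, Multiset.card_zero] at hcard; omega
  have hB' : (s'.map fun α => ((X - C α) * (X - C α⁻¹) : ℂ[X])).prod.mahlerMeasure < B := by
    rw [← hP]; exact hB
  have h := powerSum_bound_strict s' hs0 hs hk hB'
  rw [hcard, ← roots_powerSum_eq, ← hP] at h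
  linarith

/-! ## The `rec` family, odd degree -/

/-- **T2, rec family, odd degree `n = 2d+1 ≥ 3`.** -/
theorem rec_odd_coeff_test (P : ℤ[X]) (d : ℕ) (hd : 1 ≤ d) (hmonic : P.Monic) (hdeg : P.natDegree = 2 * d + 1)
    (hpal : ∀ j ≤ 2 * d + 1, P.coeff j = P.coeff (2 * d + 1 - j)) {B : ℝ} (hB : intMahlerMeasure P < B)
    (i : ℕ) (hi1 : 1 ≤ i) (hi2 : i ≤ 2 * d) :
    (|P.coeff i| : ℝ) < ((X ^ 2 + C (B + B⁻¹) * X + 1 : ℝ[X]) * (X + 1) ^ (2 * d - 1)).coeff i := by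
  obtain ⟨R, hPR, hRmonic, hRdeg, hRpal⟩ := odd_palindromic_decomposition P d hmonic hdeg hpal
  obtain ⟨s, hcard, hR⟩ := int_palindromic_factorisation R d hRmonic hRdeg hRpal
  have hs : s ≠ 0 := by intro h; rw [h, Multiset.card_zero] at hcard; omega
  -- M(P) = M(R)
  have hMR : intMahlerMeasure R = intMahlerMeasure P := by
    unfold intMahlerMeasure
    rw [hPR, Polynomial.map_mul, mahlerMeasure_mul,
      show ((X + 1 : ℤ[X]).map (Int.castRingHom ℂ)) = X + C 1 by simp, mahlerMeasure_X_add_C]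
    simp
  have hMR' : (R.map (Int.castRingHom ℂ)).mahlerMeasure = intMahlerMeasure P := hMR
  -- domination of P.map = (X+1) * R.map
  have hdomR := dominates_rec_product s hs
  rw [← hR, hcard, hMR'] at hdomR
  have hdom1 : Dominates (X + 1 : ℝ[X]) ((X + 1 : ℤ[X]).map (Int.castRingHom ℂ)) := by
    intro j
    rw [Polynomial.map_add, Polynomial.map_one, map_X]
    rcases j with _ | _ | j <;> simp [coeff_X, coeff_one]
  have hdom : Dominates ((X ^ 2 + C (intMahlerMeasure P + (intMahlerMeasure P)⁻¹) * X + 1 : ℝ[X]) *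
      (X + 1) ^ (2 * d - 1)) (P.map (Int.castRingHom ℂ)) := by
    have h := hdom1.mul hdomR
    rw [← Polynomial.map_mul, ← hPR] at h
    have heq : (X + 1 : ℝ[X]) * ((X ^ 2 + C (intMahlerMeasure P + (intMahlerMeasure P)⁻¹) * X + 1) *
        (X + 1) ^ (2 * (d - 1))) = (X ^ 2 + C (intMahlerMeasure P + (intMahlerMeasure P)⁻¹) * X + 1) *
        (X + 1) ^ (2 * d - 1) := by
      rw [show 2 * d - 1 = 2 * (d - 1) + 1 by omega, pow_succ]; ring
    rw [heq] at h
    exact h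
  have hM1 := one_le_intMahlerMeasure_of_monic hmonic
  obtain ⟨j, rfl⟩ : ∃ j, i = j + 1 := ⟨i - 1, by omega⟩
  have h := strict_of_dominates _ (add_inv_lt_add_inv hM1 hB) _ (coeffNonneg_X_add_one_pow _) hdom j
    (coeff_X_add_one_pow_pos (by omega))
  rw [coeff_map] at h
  simpa [Complex.norm_intCast] using h

/-- **T1, rec family, odd degree.** -/
theorem rec_odd_powerSum_test (P : ℤ[X]) (d : ℕ) (hd : 1 ≤ d) (hmonic : P.Monic) (hdeg : P.natDegree = 2 * d + 1)
    (hpal : ∀ j ≤ 2 * d + 1, P.coeff j = P.coeff (2 * d + 1 - j)) {B : ℝ} (hB : intMahlerMeasure P < B)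
    {k : ℕ} (hk : 0 < k) :
    ‖(((P.map (Int.castRingHom ℂ)).roots).map fun z => z ^ k).sum‖ < (2 * d - 1 : ℝ) + B ^ k + (B ^ k)⁻¹ := by
  obtain ⟨R, hPR, hRmonic, hRdeg, hRpal⟩ := odd_palindromic_decomposition P d hmonic hdeg hpal
  have hMR : intMahlerMeasure R = intMahlerMeasure P := by
    unfold intMahlerMeasure
    rw [hPR, Polynomial.map_mul, mahlerMeasure_mul,
      show ((X + 1 : ℤ[X]).map (Int.castRingHom ℂ)) = X + C 1 by simp, mahlerMeasure_X_add_C]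
    simp
  have hRB : intMahlerMeasure R < B := by rw [hMR]; exact hB
  have hR := rec_even_powerSum_test R d hd hRmonic hRdeg hRpal hRB hk
  have hne : ((X + 1 : ℤ[X]) * R).map (Int.castRingHom ℂ) ≠ 0 :=
    Polynomial.map_monic_ne_zero (by rw [← hPR]; exact hmonic)
  rw [hPR, Polynomial.map_mul, roots_mul (by rw [← Polynomial.map_mul]; exact hne), Multiset.map_add,
    Multiset.sum_add]
  have h1 : ((X + 1 : ℤ[X]).map (Int.castRingHom ℂ)).roots = {-1} := by
    rw [Polynomial.map_add, Polynomial.map_one, map_X, show (X + 1 : ℂ[X]) = X - C (-1) by simp, roots_X_sub_C]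
  rw [h1, Multiset.map_singleton, Multiset.sum_singleton]
  calc ‖(-1 : ℂ) ^ k + ((R.map (Int.castRingHom ℂ)).roots.map fun z => z ^ k).sum‖
      ≤ ‖(-1 : ℂ) ^ k‖ + ‖((R.map (Int.castRingHom ℂ)).roots.map fun z => z ^ k).sum‖ := norm_add_le _ _
    _ = 1 + ‖((R.map (Int.castRingHom ℂ)).roots.map fun z => z ^ k).sum‖ := by simp
    _ < 1 + ((2 * d - 2 : ℝ) + B ^ k + (B ^ k)⁻¹) := by linarith
    _ = _ := by ring

/-! ## The `anti` family -/

/-- **T2, anti family, even degree `n = 2d ≥ 2`.** -/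
theorem anti_coeff_test (P : ℤ[X]) (d : ℕ) (hd : 1 ≤ d) (hmonic : P.Monic) (hdeg : P.natDegree = 2 * d)
    (hapal : ∀ j ≤ 2 * d, P.coeff j = -P.coeff (2 * d - j)) {B : ℝ} (hB : intMahlerMeasure P < B)
    (i : ℕ) (hi1 : 1 ≤ i) (hi2 : i ≤ 2 * d - 1) :
    (|P.coeff i| : ℝ) < ((X ^ 2 + C (B + B⁻¹) * X + 1 : ℝ[X]) * (X + 1) ^ (2 * d - 2)).coeff i := by
  obtain ⟨R, hPR, hRmonic, hRdeg, hRpal⟩ := antipalindromic_decomposition P d hd hmonic hdeg hapal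
  have hM1 := one_le_intMahlerMeasure_of_monic hmonic
  have hQfac : ((X ^ 2 - 1 : ℤ[X]).map (Int.castRingHom ℂ)) = (X - C 1) * (X - C (-1)) := by
    simp; ring
  have hQ1 : ((X ^ 2 - 1 : ℤ[X]).map (Int.castRingHom ℂ)).mahlerMeasure = 1 := by
    rw [hQfac, mahlerMeasure_mul, mahlerMeasure_X_sub_C, mahlerMeasure_X_sub_C]
    simp
  have hMR : intMahlerMeasure R = intMahlerMeasure P := by
    unfold intMahlerMeasure
    rw [hPR, Polynomial.map_mul, mahlerMeasure_mul, hQ1, one_mul]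
  have hMR' : (R.map (Int.castRingHom ℂ)).mahlerMeasure = intMahlerMeasure P := hMR
  have hdomQ : Dominates (X ^ 2 + 1 : ℝ[X]) ((X ^ 2 - 1 : ℤ[X]).map (Int.castRingHom ℂ)) := by
    intro j
    rw [Polynomial.map_sub, Polynomial.map_pow, Polynomial.map_one, map_X]
    rcases j with _ | _ | _ | j <;> simp [coeff_X_pow, coeff_one]
  -- domination of P.map by (X² + C m X + 1) * (X+1)^(2d-2), m = M + 1/M
  have hdom : Dominates ((X ^ 2 + C (intMahlerMeasure P + (intMahlerMeasure P)⁻¹) * X + 1 : ℝ[X]) *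
      (X + 1) ^ (2 * d - 2)) (P.map (Int.castRingHom ℂ)) := by
    by_cases hd1 : d = 1
    · -- R = 1, P = x² - 1
      subst hd1
      have hR1 : R = 1 := by
        rw [show (2 * 1 - 2 : ℕ) = 0 from rfl] at hRdeg
        exact Polynomial.eq_one_of_monic_natDegree_zero hRmonic hRdeg
      have hPm : P.map (Int.castRingHom ℂ) = (X ^ 2 - 1 : ℤ[X]).map (Int.castRingHom ℂ) := by
        rw [hPR, hR1, mul_one]
      rw [hPm]
      intro j
      refine le_trans (hdomQ j) ?_
      rw [show (2 * 1 - 2 : ℕ) = 0 from rfl, pow_zero, mul_one, coeff_realQuad]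
      have hm : 0 ≤ intMahlerMeasure P + (intMahlerMeasure P)⁻¹ :=
        add_nonneg (intMahlerMeasure_nonneg P) (inv_nonneg.mpr (intMahlerMeasure_nonneg P))
      rcases j with _ | _ | _ | j <;> simp [coeff_X_pow, coeff_one, hm]
    · have hd2 : 2 ≤ d := by omega
      obtain ⟨s, hcard, hR⟩ := int_palindromic_factorisation R (d - 1) hRmonic (by rw [hRdeg]; omega)
        (fun j hj => by rw [show 2 * (d - 1) = 2 * d - 2 by omega]; exact hRpal j (by omega))
      have hs : s ≠ 0 := by intro h; rw [h, Multiset.card_zero] at hcard; omega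
      have hdomR := dominates_rec_product s hs
      rw [← hR, hcard, hMR'] at hdomR
      have h := hdomQ.mul hdomR
      rw [← Polynomial.map_mul, ← hPR] at h
      -- (X²+1) * (Q * (X+1)^(2(d-2))) ≤ Q * (X+1)^(2d-2)
      refine h.mono ?_
      set Q : ℝ[X] := X ^ 2 + C (intMahlerMeasure P + (intMahlerMeasure P)⁻¹) * X + 1 with hQ
      have hQnn : CoeffNonneg Q := by
        rw [hQ]; apply coeffNonneg_realQuad
        exact add_nonneg (intMahlerMeasure_nonneg P) (inv_nonneg.mpr (intMahlerMeasure_nonneg P))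
      have hle : CoeffLE (X ^ 2 + 1 : ℝ[X]) ((X + 1) ^ 2) := by
        intro j
        rw [show ((X + 1 : ℝ[X]) ^ 2) = X ^ 2 + C 2 * X + 1 by
          rw [show (C 2 : ℝ[X]) = 2 from map_ofNat C 2]; ring, coeff_realQuad]
        rcases j with _ | _ | _ | j <;> simp [coeff_X_pow, coeff_one]
      have h2 := (hle.mul_right (hQnn.mul (coeffNonneg_X_add_one_pow (2 * (d - 1 - 1)))))
      rw [show ((X + 1 : ℝ[X]) ^ 2 * (Q * (X + 1) ^ (2 * (d - 1 - 1)))) = Q * (X + 1) ^ (2 * d - 2) by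
        rw [show 2 * d - 2 = 2 * (d - 1 - 1) + 2 by omega, pow_add]; ring] at h2
      exact h2
  obtain ⟨j, rfl⟩ : ∃ j, i = j + 1 := ⟨i - 1, by omega⟩
  have h := strict_of_dominates _ (add_inv_lt_add_inv hM1 hB) _ (coeffNonneg_X_add_one_pow _) hdom j
    (coeff_X_add_one_pow_pos (by omega))
  rw [coeff_map] at h
  simpa [Complex.norm_intCast] using h

/-- **T1, anti family.** -/
theorem anti_powerSum_test (P : ℤ[X]) (d : ℕ) (hd : 1 ≤ d) (hmonic : P.Monic) (hdeg : P.natDegree = 2 * d)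
    (hapal : ∀ j ≤ 2 * d, P.coeff j = -P.coeff (2 * d - j)) {B : ℝ} (hB : intMahlerMeasure P < B)
    {k : ℕ} (hk : 0 < k) :
    ‖(((P.map (Int.castRingHom ℂ)).roots).map fun z => z ^ k).sum‖ < (2 * d - 2 : ℝ) + B ^ k + (B ^ k)⁻¹ := by
  obtain ⟨R, hPR, hRmonic, hRdeg, hRpal⟩ := antipalindromic_decomposition P d hd hmonic hdeg hapal
  have hM1 := one_le_intMahlerMeasure_of_monic hmonic
  have hQfac : ((X ^ 2 - 1 : ℤ[X]).map (Int.castRingHom ℂ)) = (X - C 1) * (X - C (-1)) := by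
    simp; ring
  have hQ1 : ((X ^ 2 - 1 : ℤ[X]).map (Int.castRingHom ℂ)).mahlerMeasure = 1 := by
    rw [hQfac, mahlerMeasure_mul, mahlerMeasure_X_sub_C, mahlerMeasure_X_sub_C]
    simp
  have hMR : intMahlerMeasure R = intMahlerMeasure P := by
    unfold intMahlerMeasure
    rw [hPR, Polynomial.map_mul, mahlerMeasure_mul, hQ1, one_mul]
  have hne : ((X ^ 2 - 1 : ℤ[X]) * R).map (Int.castRingHom ℂ) ≠ 0 :=
    Polynomial.map_monic_ne_zero (by rw [← hPR]; exact hmonic)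
  have hQroots : ((X ^ 2 - 1 : ℤ[X]).map (Int.castRingHom ℂ)).roots = {1, -1} := by
    rw [hQfac, roots_mul (mul_ne_zero (X_sub_C_ne_zero 1) (X_sub_C_ne_zero (-1))), roots_X_sub_C,
      roots_X_sub_C]
    rfl
  have hpair : ((({1, -1} : Multiset ℂ)).map fun z => z ^ k).sum = 1 + (-1) ^ k := by simp
  rw [hPR, Polynomial.map_mul, roots_mul (by rw [← Polynomial.map_mul]; exact hne), Multiset.map_add,
    Multiset.sum_add, hQroots, hpair]
  have hBk : (2 : ℝ) < B ^ k + (B ^ k)⁻¹ := by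
    have := pow_add_inv_pow_lt (le_refl (1 : ℝ)) (lt_of_le_of_lt hM1 hB) hk
    rw [one_pow, inv_one] at this
    linarith
  have hfirst : ‖(1 : ℂ) + (-1) ^ k‖ ≤ 2 := by
    calc ‖(1 : ℂ) + (-1) ^ k‖ ≤ ‖(1 : ℂ)‖ + ‖(-1 : ℂ) ^ k‖ := norm_add_le _ _
      _ = 2 := by rw [norm_pow, norm_neg, norm_one, one_pow]; norm_num
  -- the R part
  have hSR : ‖((R.map (Int.castRingHom ℂ)).roots.map fun z => z ^ k).sum‖ + 2 <
      (2 * d - 2 : ℝ) + B ^ k + (B ^ k)⁻¹ := by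
    by_cases hd1 : d = 1
    · subst hd1
      have hR1 : R = 1 := by
        rw [show (2 * 1 - 2 : ℕ) = 0 from rfl] at hRdeg
        exact Polynomial.eq_one_of_monic_natDegree_zero hRmonic hRdeg
      rw [hR1, Polynomial.map_one, roots_one]
      simp only [Multiset.empty_eq_zero, Multiset.map_zero, Multiset.sum_zero, norm_zero, Nat.cast_one]
      linarith
    · have hRB : intMahlerMeasure R < B := by rw [hMR]; exact hB
      have hR := rec_even_powerSum_test R (d - 1) (by omega) hRmonic (by rw [hRdeg]; omega)
        (fun j hj => by rw [show 2 * (d - 1) = 2 * d - 2 by omega]; exact hRpal j (by omega)) hRB hk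
      have hcast : ((d - 1 : ℕ) : ℝ) = (d : ℝ) - 1 := by
        rw [Nat.cast_sub hd]; simp
      rw [hcast] at hR
      linarith
  calc ‖(1 : ℂ) + (-1) ^ k + ((R.map (Int.castRingHom ℂ)).roots.map fun z => z ^ k).sum‖
      ≤ ‖(1 : ℂ) + (-1) ^ k‖ + ‖((R.map (Int.castRingHom ℂ)).roots.map fun z => z ^ k).sum‖ :=
        norm_add_le _ _
    _ < _ := by linarith

/-! ## Graeffe transfer -/

/-- Along a Graeffe chain of `m` steps the bound transfers as `B ↦ B^{2^m}` (`thresholds.py`: `Bm = Bm * Bm`). -/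
theorem graeffe_bound {P Q : ℤ[X]} {m : ℕ} (hG : GraeffeChain P m Q) {B : ℝ} (hB : intMahlerMeasure P < B) :
    intMahlerMeasure Q < B ^ 2 ^ m := by
  rw [intMahlerMeasure_of_graeffeChain hG]
  exact pow_lt_pow_left₀ hB (intMahlerMeasure_nonneg P) (pow_ne_zero m two_ne_zero)

end Summit.Ventures.DiscreteObjects.Mahler
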